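import Literature.Analysis.FluidPDE.CylindricalTrajectory
import Literature.Analysis.FluidPDE.TimeAverageSupport
import HarnessLib

/-!
# Time-average measures satisfy the stationary Liouville equation

Analysis/FluidPDE support file for the discharge of
`Literature.Analysis.FluidPDE.timeAverage_isStationary` (Foias–Manley–Rosa–Temam 2001, Ch. IV
Thm. 3.1 with App. B.2): property **(1.30)** of a stationary statistical solution,

  `∫ ⟨F(u), Φ'(u)⟩ dμ(u) = 0`   for every cylindrical test functional `Φ`,

for every time-average measure `μ` of a global Leray–Hopf solution `u` on `T^d` with viscosity
`ν > 0` and steady force `F ∈ L²` (`IsTimeAverageMeasure.integral_nsGeneratorPairing_grad_eq_zero`).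

Proof (FMRT 2001, App. B.2, (B.18)–(B.20), PDF pp. 256–257; in the tree's setting all space
derivatives fall on the smooth `gᵢ`, so the tested generator `u ↦ ⟨F(u), Φ'(u)⟩` is
norm-continuous on `H` with quadratic growth, `CylindricalGenerator`, and no approximation
`F_k`, `Φ_m` is needed): the trajectory stays in a closed ball `B` (`TimeAverageSupport`), on
which the generator is bounded, so `∫ ⟨F(u), Φ'(u)⟩ dμ = Lim T⁻¹ ∫₀ᵀ ⟨F(u(t)), Φ'(u(t))⟩ dt`
(`IsTimeAverageMeasure.integral_eq_of_eqOn`); by the chain rule in integral form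
(`IsGlobalLerayHopf.cylindrical_eval_sub_eq_integral`, `CylindricalTrajectory`)
`∫₁ᵀ ⟨F(u), Φ'(u)⟩ = Φ(u(T)) − Φ(u(1))` is bounded ((B.19)), and `∫₀¹` is bounded too, so the
time means are `O(1/T)` and their generalized limit vanishes ((B.20)).

## References

* C. Foias, O. Manley, R. Rosa, R. Temam, *Navier–Stokes Equations and Turbulence*, Cambridge
  Univ. Press (2001), Ch. IV §1.2 Def. 1.3 (1.30) (PDF p. 197); App. B.2 (B.18)–(B.23)
  (PDF pp. 256–258). [FMRT2001]
-/

noncomputable section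

open MeasureTheory Set Filter Topology UnitAddTorus
open scoped InnerProductSpace RealInnerProductSpace ENNReal NNReal

namespace Literature.Analysis.FluidPDE.Torus

variable {d : Type*} [Fintype d] [DecidableEq d]

variable {ν : ℝ} {F u₀ : UnitAddTorus d → EuclideanSpace ℝ d} {u : ℝ → UnitAddTorus d → EuclideanSpace ℝ d}
  {U : ℝ → FunctionSpaces.Torus.energySpace d}
  {Λ : GeneralizedLimit} {μ : Measure (FunctionSpaces.Torus.energySpace d)}

/-- **Time-average measures satisfy the stationary Liouville equation, FMRT (1.30)**: for a
time-average measure `μ` of a global Leray–Hopf solution on `T^d` (`ν > 0`, steady force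
`F ∈ L²`, slices lifted to `H`) and every cylindrical test functional `Φ`, the tested generator
`u ↦ ⟨F(u), Φ'(u)⟩` is `μ`-integrable and `∫ ⟨F(u), Φ'(u)⟩ dμ(u) = 0` — the second defining
property of a stationary statistical solution (FMRT 2001, Ch. IV Def. 1.3 (1.30); Thm. 3.1,
proof in App. B.2, (B.18)–(B.23)). The time means `T⁻¹ ∫₀ᵀ ⟨F(u(t)), Φ'(u(t))⟩ dt` are
`O(1/T)` by the chain rule `∫₁ᵀ ⟨F(u), Φ'(u)⟩ = Φ(u(T)) − Φ(u(1))` and boundedness of `Φ`. [cite: FMRT2001, Ch. IV Thm. 3.1; App. B.2 (B.18)–(B.23)] -/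
theorem IsTimeAverageMeasure.integral_nsGeneratorPairing_grad_eq_zero (hν : 0 < ν)
    (hF : MemLp F 2 volume) (hu : IsGlobalLerayHopf ν (fun _ => F) u₀ u)
    (hU : ∀ t, 0 ≤ t →
      ((U t : Lp (EuclideanSpace ℝ d) 2 (volume : Measure (UnitAddTorus d))) :
        UnitAddTorus d → EuclideanSpace ℝ d) =ᵐ[volume] u t)
    (hμ : IsTimeAverageMeasure Λ.longTimeAvg U μ) (Φ : CylindricalTest d) :
    Integrable (fun v : FunctionSpaces.Torus.energySpace d => nsGeneratorPairing ν F v (Φ.grad v)) μ ∧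
      ∫ v, nsGeneratorPairing ν F v (Φ.grad v) ∂μ = 0 := by
  obtain ⟨R, hR0, hR⟩ := hu.exists_forall_lift_mem_closedBall hν hF hU
  obtain ⟨hθc, hθ1, hθ0, hθ01⟩ := energyCutoff_props R
  obtain ⟨K, hK0, hK⟩ := exists_abs_nsGeneratorPairing_grad_le ν hF Φ
  obtain ⟨B, hB⟩ := Φ.exists_abs_eval_le
  have hB0 : 0 ≤ B := (abs_nonneg _).trans (hB (U 0))
  set G : FunctionSpaces.Torus.energySpace d → ℝ := fun v =>
    nsGeneratorPairing ν F v (Φ.grad v) with hG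
  have hGc : Continuous G := continuous_nsGeneratorPairing_grad ν (hF.integrable one_le_two) Φ
  -- the bounded continuous modification outside the carrying ball
  set Ψ : FunctionSpaces.Torus.energySpace d → ℝ := fun v =>
    max 0 (min 1 (R + 1 - ‖v‖ ^ 2)) * G v with hΨ
  have hΨc : Continuous Ψ := (hθc.comp (continuous_norm.pow 2)).mul hGc
  set C : ℝ := K * (1 + (R + 1)) with hC
  have hGb : ∀ v : FunctionSpaces.Torus.energySpace d, ‖v‖ ^ 2 ≤ R + 1 → |G v| ≤ C :=
    fun v hv => (hK v).trans (by rw [hC]; gcongr)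
  have hC0 : 0 ≤ C := by rw [hC]; positivity
  have hΨb : ∀ v, |Ψ v| ≤ C := by
    intro v
    rw [hΨ]
    dsimp only
    by_cases hv : ‖v‖ ^ 2 ≤ R + 1
    · rw [abs_mul, abs_of_nonneg (hθ01 _).1]
      calc max 0 (min 1 (R + 1 - ‖v‖ ^ 2)) * |G v| ≤ 1 * C :=
            mul_le_mul (hθ01 _).2 (hGb v hv) (abs_nonneg _) zero_le_one
        _ = C := one_mul _
    · rw [hθ0 _ (le_of_lt (not_le.1 hv)), zero_mul, abs_zero]
      exact hC0
  have heq : EqOn G Ψ (Metric.closedBall (0 : FunctionSpaces.Torus.energySpace d) (Real.sqrt R)) := by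
    intro v hv
    have hv' := norm_sq_le_of_mem_closedBall_sqrt hR0 hv
    rw [hΨ]
    dsimp only
    rw [hθ1 _ hv', one_mul]
  obtain ⟨hGi, hGint⟩ := hμ.integral_eq_of_eqOn Metric.isClosed_closedBall
    (fun t ht => (hR t ht).2) hΨc hΨb heq
  refine ⟨hGi, ?_⟩
  rw [hGint]
  -- the time means are `O(1/T)`
  refine Λ.longTimeAvg_eq_of_tendsto ?_
  have hGU : ∀ t, 0 ≤ t → |G (U t)| ≤ C := fun t ht => hGb _ ((hR t ht).1.trans (by linarith))
  have hbd : ∀ T, 1 ≤ T → |∫ t in (0 : ℝ)..T, G (U t)| ≤ C + 2 * B := by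
    intro T hT
    by_cases hint : IntervalIntegrable (fun t => G (U t)) volume 0 T
    · have h01 : IntervalIntegrable (fun t => G (U t)) volume 0 1 :=
        hint.mono_set (by
          rw [uIcc_of_le zero_le_one, uIcc_of_le (zero_le_one.trans hT)]
          exact Icc_subset_Icc le_rfl hT)
      have h1T : IntervalIntegrable (fun t => G (U t)) volume 1 T :=
        hint.mono_set (by
          rw [uIcc_of_le hT, uIcc_of_le (zero_le_one.trans hT)]
          exact Icc_subset_Icc zero_le_one le_rfl)
      rw [← intervalIntegral.integral_add_adjacent_intervals h01 h1T,
        ← hu.cylindrical_eval_sub_eq_integral hF hU Φ one_pos hT]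
      have hI1 : |∫ t in (0 : ℝ)..1, G (U t)| ≤ C := by
        have := intervalIntegral.norm_integral_le_of_norm_le_const (a := (0 : ℝ)) (b := 1)
          (f := fun t => G (U t)) (C := C) fun t ht => by
            rw [uIoc_of_le zero_le_one] at ht
            rw [Real.norm_eq_abs]
            exact hGU t ht.1.le
        rwa [sub_zero, abs_one, mul_one, Real.norm_eq_abs] at this
      have hI2 : |Φ.eval (U T) - Φ.eval (U 1)| ≤ 2 * B :=
        (abs_sub _ _).trans (by linarith [hB (U T), hB (U 1)])
      exact (abs_add_le _ _).trans (add_le_add hI1 hI2)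
    · rw [intervalIntegral.integral_undef hint, abs_zero]
      positivity
  have hlim : Tendsto (fun T : ℝ => (C + 2 * B) * T⁻¹) atTop (𝓝 0) := by
    simpa using tendsto_inv_atTop_zero.const_mul (C + 2 * B)
  refine squeeze_zero_norm' ?_ hlim
  filter_upwards [eventually_ge_atTop 1] with T hT
  have hT0 : 0 < T := one_pos.trans_le hT
  unfold timeMean
  rw [Real.norm_eq_abs, abs_mul, abs_inv, abs_of_pos hT0, mul_comm]
  exact mul_le_mul_of_nonneg_right (hbd T hT) (inv_nonneg.2 hT0.le)

end Literature.Analysis.FluidPDE.Torus
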